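import Literature.NumberTheory.ConnesConsani2021.QuasiInnerPrimeOffDiag
import HarnessLib

/-!
# Connes–Consani 2021 (JNT) §4.3 — the finite-rank term `ℰ₀` of Theorem 4.4 (ii) (bricks)

LINE 1 — LABEL: RH-FREE corpus literature (the rank-`≤ 2` operator produced by the double pole of
`ρ_∞ρ_p` at `z = 0`: «The contribution of the terms in `αx^{k−1}` gives `α(1 − 𝒫)f_x𝒫` … The contribution
of the terms `β(k−1)x^{k−1}` gives `xβ(1 − 𝒫)f_x²𝒫` … Thus this contribution gives an operator of rank
`2`»); bears_on: W-C/W-P (P5 sequel vocabulary, no leaf role); WHAT THIS IS NOT: any claim about RH —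
nothing in this file bears on the truth of RH.

Source: A. Connes, C. Consani, *Quasi-inner functions and local factors*, J. Number Theory **226**
(2021) 139–167 = arXiv:2008.10974 [bib: `ConnesConsani2021QuasiInner`], Theorem 4.4 (ii) proof
(arXiv chunk p0012:L10–L18). THEOREMS ONLY; vocabulary = `QuasiInnerLocalFactors` (`xiVec`, `etaVec`,
`hardyIsoPlus/Minus`, `fourierLp`).

## Content (RH-FREE)

* `inner_fourierLp_negSucc_hardyIsoMinus`, `inner_fourierLp_natCast_hardyIsoMinus`,
  `inner_fourierLp_natCast_hardyIsoPlus`, `inner_fourierLp_negSucc_hardyIsoPlus` — the Fourier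
  coefficients of `U_−(g)`, `U_+(g)`.
* `exists_finiteRank_doublePoleOperator` — for all constants `P, Q` and every `x` in the open unit disk
  there is a FINITE-RANK operator `E₀` on `L²(S¹)` with matrix `⟨e_{−k−1}|E₀ e_b⟩ = P x^{k+b} +
  Q (k+b) x^{k+b−1}` (`b ≥ 0`), rows `a ≥ 0` and columns `b < 0` zero — the shape
  «`αx^{k−1} + (k−1)βx^{k−1}`» of the residue at the double pole (`x = −1/3`), realised as
  `P|ξ_x⟩⟨η_x| + Q(|ξ′⟩⟨η_x| + |ξ_x⟩⟨η′|)` with `ξ′ = Σ k x^{k−1}e_{−k−1}`, `η′ = Σ b x̄^{b−1} e_b`.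

Nothing in this file bears on the truth of RH.
-/

noncomputable section

open _root_.MeasureTheory _root_.Complex AddCircle Filter Set
open scoped Real ENNReal Topology InnerProductSpace ComplexConjugate

namespace Literature.NumberTheory.ConnesConsani2021

namespace QuasiInner

/-! ### Fourier coefficients of `U_±(g)` -/

/-- `⟨e_{σ(k₀)} | Σ_k g(k) e_{σ(k)}⟩ = g(k₀)` for an injective relabelling `σ` (orthonormality of
the modes). [folklore] -/
private theorem zp_inner_of_hasSum_eq {g : ℕ → ℂ} {σ : ℕ → ℤ} (hσ : Function.Injective σ)
    {v : Lp ℂ 2 (haarAddCircle (T := (1 : ℝ)))}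
    (hv : HasSum (fun k : ℕ => g k • fourierLp (T := 1) 2 (σ k)) v) (k₀ : ℕ) :
    ⟪fourierLp (T := 1) 2 (σ k₀), v⟫_ℂ = g k₀ := by
  classical
  have h1 := (innerSL ℂ (fourierLp (T := 1) 2 (σ k₀))).hasSum hv
  simp only [innerSL_apply_apply, inner_smul_right] at h1
  have horth := orthonormal_fourier (T := (1 : ℝ))
  rw [orthonormal_iff_ite] at horth
  have hterm : (fun k : ℕ => g k * ⟪fourierLp (T := 1) 2 (σ k₀), fourierLp (T := 1) 2 (σ k)⟫_ℂ) =
      fun k => if k = k₀ then g k₀ else 0 := by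
    funext k
    rw [horth]
    by_cases h : k = k₀
    · subst h; simp
    · rw [if_neg (fun e => h (hσ e).symm), if_neg h, mul_zero]
  rw [hterm] at h1
  exact h1.unique (hasSum_ite_eq k₀ (g k₀))

/-- `⟨e_n | Σ_k g(k) e_{σ(k)}⟩ = 0` for `n ∉ range σ`. [folklore] -/
private theorem zp_inner_of_hasSum_zero {g : ℕ → ℂ} {σ : ℕ → ℤ}
    {v : Lp ℂ 2 (haarAddCircle (T := (1 : ℝ)))}
    (hv : HasSum (fun k : ℕ => g k • fourierLp (T := 1) 2 (σ k)) v) {n : ℤ} (hn : ∀ k, σ k ≠ n) :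
    ⟪fourierLp (T := 1) 2 n, v⟫_ℂ = 0 := by
  classical
  have h1 := (innerSL ℂ (fourierLp (T := 1) 2 n)).hasSum hv
  simp only [innerSL_apply_apply, inner_smul_right] at h1
  have horth := orthonormal_fourier (T := (1 : ℝ))
  rw [orthonormal_iff_ite] at horth
  have hterm : (fun k : ℕ => g k * ⟪fourierLp (T := 1) 2 n, fourierLp (T := 1) 2 (σ k)⟫_ℂ) =
      fun _ => 0 := by
    funext k
    rw [horth, if_neg (fun e => hn k e.symm), mul_zero]
  rw [hterm] at h1
  exact h1.unique hasSum_zero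

/-- `⟨e_{−k−1} | U_−(g)⟩ = g(k)`. [cite: ConnesConsani2021QuasiInner, §3 (arXiv chunk p0008:L129)] -/
theorem inner_fourierLp_negSucc_hardyIsoMinus (g : lp (fun _ : ℕ => ℂ) 2) (k : ℕ) :
    ⟪fourierLp (T := 1) 2 (-(k + 1 : ℤ)), hardyIsoMinus 1 g⟫_ℂ = g k := by
  have hσ : Function.Injective (fun k : ℕ => (-(k + 1 : ℤ))) := fun a b h => by
    simpa using h
  exact zp_inner_of_hasSum_eq hσ (hasSum_hardyIsoMinus 1 g) k

/-- `⟨e_a | U_−(g)⟩ = 0` for `a ≥ 0`. [cite: ConnesConsani2021QuasiInner, §3 (arXiv chunk p0008:L129)] -/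
theorem inner_fourierLp_natCast_hardyIsoMinus (g : lp (fun _ : ℕ => ℂ) 2) (a : ℕ) :
    ⟪fourierLp (T := 1) 2 (a : ℤ), hardyIsoMinus 1 g⟫_ℂ = 0 :=
  zp_inner_of_hasSum_zero (hasSum_hardyIsoMinus 1 g) fun k h => by omega

/-- `⟨e_b | U_+(g)⟩ = g(b)`. [cite: ConnesConsani2021QuasiInner, §3 (arXiv chunk p0008:L129)] -/
theorem inner_fourierLp_natCast_hardyIsoPlus (g : lp (fun _ : ℕ => ℂ) 2) (b : ℕ) :
    ⟪fourierLp (T := 1) 2 (b : ℤ), hardyIsoPlus 1 g⟫_ℂ = g b := by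
  have hσ : Function.Injective (fun k : ℕ => (k : ℤ)) := fun a b h => by simpa using h
  exact zp_inner_of_hasSum_eq hσ (hasSum_hardyIsoPlus 1 g) b

/-- `⟨e_{−m−1} | U_+(g)⟩ = 0`. [cite: ConnesConsani2021QuasiInner, §3 (arXiv chunk p0008:L129)] -/
theorem inner_fourierLp_negSucc_hardyIsoPlus (g : lp (fun _ : ℕ => ℂ) 2) (m : ℕ) :
    ⟪fourierLp (T := 1) 2 (-(m + 1 : ℤ)), hardyIsoPlus 1 g⟫_ℂ = 0 :=
  zp_inner_of_hasSum_zero (hasSum_hardyIsoPlus 1 g) fun k h => by omega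

/-! ### The derivative sequence `k x^{k−1}` in `ℓ²` -/

/-- `k ↦ k x^{k−1}` is square-summable for `|x| < 1`. [folklore] -/
private theorem zp_memℓp_deriv_seq {x : ℂ} (hx : ‖x‖ < 1) :
    Memℓp (fun k : ℕ => (k : ℂ) * x ^ (k - 1)) 2 := by
  rw [memℓp_gen_iff (by norm_num)]
  have h2 : ‖x‖ ^ 2 < 1 := by nlinarith [norm_nonneg x]
  have hs := summable_pow_mul_geometric_of_norm_lt_one 2
    (show ‖(‖x‖ ^ 2 : ℝ)‖ < 1 by rw [Real.norm_of_nonneg (by positivity)]; exact h2)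
  -- `‖k x^{k-1}‖² = k² (|x|²)^{k-1} ≤ k² (|x|²)^k / |x|²`… we compare with the shifted series
  have hs' : Summable fun k : ℕ => ((k + 1 : ℕ) : ℝ) ^ 2 * (‖x‖ ^ 2) ^ k := by
    have := (summable_nat_add_iff 1).2 hs
    by_cases hx0 : ‖x‖ = 0
    · refine summable_of_ne_finset_zero (s := {0}) fun k hk => ?_
      rw [Finset.mem_singleton] at hk
      rw [hx0, zero_pow two_ne_zero, zero_pow hk, mul_zero]
    · have hpos : 0 < ‖x‖ ^ 2 := by positivity
      refine (this.mul_left ((‖x‖ ^ 2)⁻¹)).congr fun k => ?_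
      simp only [pow_succ]
      field_simp
  refine (summable_nat_add_iff 1).1 ?_
  refine hs'.congr fun k => ?_
  simp only [ENNReal.toReal_ofNat, Real.rpow_two, norm_mul, norm_pow, Complex.norm_natCast,
    Nat.add_sub_cancel]
  ring

/-! ### The operator `ℰ₀` -/

/-- **The finite-rank operator of the double pole** («Thus this contribution gives an operator of rank
`2`»): for any `P, Q ∈ ℂ` and `|x| < 1` there is a finite-rank `E₀` on `L²(S¹)` with matrix
`⟨e_{−k−1}|E₀ e_b⟩ = P x^{k+b} + Q(k+b)x^{k+b−1}` (`b ≥ 0`), vanishing rows `a ≥ 0` and columns `b < 0`;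
`E₀ = P|ξ_x⟩⟨η_x| + Q(|ξ′⟩⟨η_x| + |ξ_x⟩⟨η′|)`, `ξ′ = U_−(k x^{k−1})`, `η′ = U_+(b x̄^{b−1})`.
[cite: ConnesConsani2021QuasiInner, Thm 4.4 (ii) proof (arXiv chunk p0012:L10–L18)] -/
theorem exists_finiteRank_doublePoleOperator (P Q x : ℂ) (hx : ‖x‖ < 1) :
    ∃ E₀ : Lp ℂ 2 (haarAddCircle (T := 1)) →L[ℂ] Lp ℂ 2 (haarAddCircle (T := 1)),
      FiniteDimensional ℂ (LinearMap.range E₀.toLinearMap) ∧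
      (∀ k b : ℕ, ⟪fourierLp (T := 1) 2 (-(k + 1 : ℤ)), E₀ (fourierLp (T := 1) 2 (b : ℤ))⟫_ℂ =
        P * x ^ (k + b) + Q * ((k : ℂ) * x ^ (k - 1) * x ^ b + x ^ k * ((b : ℂ) * x ^ (b - 1)))) ∧
      (∀ (a : ℕ) (v : Lp ℂ 2 (haarAddCircle (T := 1))), ⟪fourierLp (T := 1) 2 (a : ℤ), E₀ v⟫_ℂ = 0) ∧
      (∀ m : ℕ, E₀ (fourierLp (T := 1) 2 (-(m + 1 : ℤ))) = 0) := by
  have hxc : ‖conj x‖ < 1 := by rwa [RCLike.norm_conj]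
  -- the vectors
  set ξ : Lp ℂ 2 (haarAddCircle (T := 1)) := xiVec 1 x with hξ
  set η : Lp ℂ 2 (haarAddCircle (T := 1)) := etaVec 1 x with hη
  set dm : lp (fun _ : ℕ => ℂ) 2 := ⟨fun k : ℕ => (k : ℂ) * x ^ (k - 1), zp_memℓp_deriv_seq hx⟩ with hdm
  set dp : lp (fun _ : ℕ => ℂ) 2 := ⟨fun k : ℕ => (k : ℂ) * conj x ^ (k - 1), zp_memℓp_deriv_seq hxc⟩
    with hdp
  set ξ' : Lp ℂ 2 (haarAddCircle (T := 1)) := hardyIsoMinus 1 dm with hξ'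
  set η' : Lp ℂ 2 (haarAddCircle (T := 1)) := hardyIsoPlus 1 dp with hη'
  set E₀ : Lp ℂ 2 (haarAddCircle (T := 1)) →L[ℂ] Lp ℂ 2 (haarAddCircle (T := 1)) :=
    P • InnerProductSpace.rankOne ℂ ξ η +
      Q • (InnerProductSpace.rankOne ℂ ξ' η + InnerProductSpace.rankOne ℂ ξ η') with hE
  have hEv : ∀ v, E₀ v = (P * ⟪η, v⟫_ℂ + Q * ⟪η', v⟫_ℂ) • ξ + (Q * ⟪η, v⟫_ℂ) • ξ' := by
    intro v
    simp only [hE, add_apply, FunLike.coe_smul, Pi.smul_apply,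
      InnerProductSpace.rankOne_apply, smul_smul, smul_add, add_smul]
    abel
  -- Fourier coefficients of the four vectors
  have hξk : ∀ k : ℕ, ⟪fourierLp (T := 1) 2 (-(k + 1 : ℤ)), ξ⟫_ℂ = x ^ k :=
    fun k => inner_fourierLp_negSucc_xiVec 1 x hx k
  have hξa : ∀ a : ℕ, ⟪fourierLp (T := 1) 2 (a : ℤ), ξ⟫_ℂ = 0 :=
    fun a => inner_fourierLp_natCast_xiVec 1 x hx a
  have hξ'k : ∀ k : ℕ, ⟪fourierLp (T := 1) 2 (-(k + 1 : ℤ)), ξ'⟫_ℂ = (k : ℂ) * x ^ (k - 1) :=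
    fun k => inner_fourierLp_negSucc_hardyIsoMinus dm k
  have hξ'a : ∀ a : ℕ, ⟪fourierLp (T := 1) 2 (a : ℤ), ξ'⟫_ℂ = 0 :=
    fun a => inner_fourierLp_natCast_hardyIsoMinus dm a
  have hηb : ∀ b : ℕ, ⟪η, fourierLp (T := 1) 2 (b : ℤ)⟫_ℂ = x ^ b := by
    intro b
    rw [← inner_conj_symm, inner_fourierLp_natCast_etaVec _ hx b, map_pow, Complex.conj_conj]
  have hηm : ∀ m : ℕ, ⟪η, fourierLp (T := 1) 2 (-(m + 1 : ℤ))⟫_ℂ = 0 := by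
    intro m
    rw [← inner_conj_symm, inner_fourierLp_negSucc_etaVec _ hx m, map_zero]
  have hη'b : ∀ b : ℕ, ⟪η', fourierLp (T := 1) 2 (b : ℤ)⟫_ℂ = (b : ℂ) * x ^ (b - 1) := by
    intro b
    rw [← inner_conj_symm, hη', inner_fourierLp_natCast_hardyIsoPlus dp b]
    simp [hdp, map_mul, map_pow]
  have hη'm : ∀ m : ℕ, ⟪η', fourierLp (T := 1) 2 (-(m + 1 : ℤ))⟫_ℂ = 0 := by
    intro m
    rw [← inner_conj_symm, hη', inner_fourierLp_negSucc_hardyIsoPlus dp m, map_zero]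
  refine ⟨E₀, ?_, fun k b => ?_, fun a v => ?_, fun m => ?_⟩
  · -- finite rank: the range lies in `span {ξ, ξ'}`
    have hle : LinearMap.range E₀.toLinearMap ≤ Submodule.span ℂ ({ξ, ξ'} : Set _) := by
      rintro w ⟨v, rfl⟩
      rw [ContinuousLinearMap.coe_coe, hEv]
      refine Submodule.add_mem _ (Submodule.smul_mem _ _ (Submodule.subset_span (by simp)))
        (Submodule.smul_mem _ _ (Submodule.subset_span (by simp)))
    haveI : FiniteDimensional ℂ (Submodule.span ℂ ({ξ, ξ'} : Set (Lp ℂ 2 (haarAddCircle (T := 1))))) :=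
      FiniteDimensional.span_of_finite ℂ (by simp)
    exact Submodule.finiteDimensional_of_le hle
  · rw [hEv, inner_add_right, inner_smul_right, inner_smul_right, hξk, hξ'k, hηb, hη'b]
    ring
  · rw [hEv, inner_add_right, inner_smul_right, inner_smul_right, hξa, hξ'a, mul_zero, mul_zero,
      add_zero]
  · rw [hEv, hηm, hη'm, mul_zero, mul_zero, add_zero, zero_smul, zero_smul, add_zero]

end QuasiInner

end Literature.NumberTheory.ConnesConsani2021

end
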